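import Mathlib
import Literature.Analysis.FluidPDE.GaussianVortexPlanar
import Literature.Analysis.FluidPDE.GaussianVortexPlanarProofs
import Literature.Analysis.FluidPDE.GaussianVortexLinearLamGap
import Literature.Analysis.FluidPDE.GaussianVortexPoincare
import HarnessLib

/-!
# Helpers `coreL_energy_identity`, `coreL_gap` toward stub `stub_coreInverse` of the line
# `braid-closed-large-circulation-gluing` (crux stmt-AnomalousDissipation-3009, `MarginalStabilityChain.StretchedVortexRows`)

The two quadratic-form facts (I1), (I2) about the Gallay–Wayne operator
`L = strainedVorticityOperator 0 = Δ + ½ξ·∇ + 1` in `X = L²(G⁻¹dξ)`, `G = gaussVortexProfile = (4π)⁻¹e^{−|ξ|²/4}`,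
written in ground-state variables `w = G u` (`u ∈ C²(ℝ²)` with `u, Du, D²u` bounded):

* `inv_gaussVortexProfile_mul_strainedVorticityOperator_mul` — the conjugation `G⁻¹ L(Gu) = Δu − ½ Du[ξ]`
  (the tree's `strainedVorticityOperator_weight_mul` with the weight `ρ = G`, `∂ᵢG = −(ξᵢ/2)G`, and
  `Du[ξ] = ξ₀∂₀u + ξ₁∂₁u`);
* `coreL_energy_identity` — **(I1)** `⟨Lw, w⟩_X = ∫ G⁻¹ (Lw) w = −∫ G ‖Du‖²`, from the conjugation and the tree's
  Dirichlet-form identity `integral_laplacian_sub_half_drift_mul_mul_gaussVortexProfile`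
  (`∫ (Δu − ½Du[ξ]) u G = −∫ ‖Du‖² G`);
* `coreL_gap` — **(I2)** `½ ∫ G u² ≤ ∫ G ‖Du‖²` when `∫ G u = ∫ w = 0`: the Gaussian Poincaré inequality
  `integral_sq_mul_gaussVortexProfile_le` of the tree (spectral gap `½` of `L` on mean-zero vorticities,
  Gallay–Wayne 2005, Prop. 4.1 / App. A).

References: Th. Gallay, C. E. Wayne, Comm. Math. Phys. 255 (2005) 97–129, Prop. 4.1, Lemma 4.8, App. A;
Th. Gallay, C. E. Wayne, J. Math. Fluid Mech. 9 (2007), §2.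
-/

set_option linter.dupNamespace false

noncomputable section

open scoped RealInnerProductSpace Topology Laplacian
open MeasureTheory WithLp Function Filter

namespace Summit.AnomalousDissipation.AnomalousDissipation.Theorems.MarginalStabilityChainStretchedVortexRows

open Literature.Analysis.FluidPDE Literature.Analysis.UnboundedOperators

/-! ### Coordinate calculus for `G` and `Du` -/

/-- `∂ᵢG(x) = −(xᵢ/2) G(x)` along the coordinate directions (`∇G = −(x/2)G`). [folklore] -/
theorem fderiv_gaussVortexProfile_single (x : EuclideanSpace ℝ (Fin 2)) (i : Fin 2) :
    fderiv ℝ gaussVortexProfile x (EuclideanSpace.single i 1) = -(x i / 2) * gaussVortexProfile x := by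
  rw [fderiv_gaussVortexProfile_apply, EuclideanSpace.inner_single_right]
  simp only [one_mul, conj_trivial]
  ring

/-- `Du(x)[x] = x₀ ∂₀u(x) + x₁ ∂₁u(x)` on `ℝ²` (`x = x₀e₀ + x₁e₁`). [folklore] -/
theorem fderiv_apply_self_eq_coord (u : EuclideanSpace ℝ (Fin 2) → ℝ) (x : EuclideanSpace ℝ (Fin 2)) :
    fderiv ℝ u x x = x 0 * fderiv ℝ u x (EuclideanSpace.single 0 1) +
      x 1 * fderiv ℝ u x (EuclideanSpace.single 1 1) := by
  rw [← sum_inner_mul_apply_orthonormalBasis (EuclideanSpace.basisFun (Fin 2) ℝ) (fderiv ℝ u x) x]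
  simp [Fin.sum_univ_two, EuclideanSpace.basisFun_apply, EuclideanSpace.inner_single_right]

/-! ### Ground-state conjugation of `L = strainedVorticityOperator 0` by the Gaussian -/

/-- **Ground-state conjugation** `G⁻¹ L (G u) = Δu − ½ Du(x)[x]` for `u ∈ C²(ℝ²)`, where
`L = Δ + ½x·∇ + 1 = strainedVorticityOperator 0` (Gallay–Wayne 2005, (73)); from the tree's conjugation
`strainedVorticityOperator_weight_mul` with the weight `ρ = G`, `∂ᵢG = −(xᵢ/2)G`. [folklore] -/
theorem inv_gaussVortexProfile_mul_strainedVorticityOperator_mul {u : EuclideanSpace ℝ (Fin 2) → ℝ}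
    (hu : ContDiff ℝ 2 u) (x : EuclideanSpace ℝ (Fin 2)) :
    (gaussVortexProfile x)⁻¹ * strainedVorticityOperator 0 (fun η => gaussVortexProfile η * u η) x =
      Δ u x - 2⁻¹ * fderiv ℝ u x x := by
  have hρ0 : ∀ y : EuclideanSpace ℝ (Fin 2), fderiv ℝ gaussVortexProfile y (EuclideanSpace.single 0 (1 : ℝ)) =
      -((1 + 0) * y 0 / 2) * gaussVortexProfile y := fun y => by
    rw [fderiv_gaussVortexProfile_single]; ring
  have hρ1 : ∀ y : EuclideanSpace ℝ (Fin 2), fderiv ℝ gaussVortexProfile y (EuclideanSpace.single 1 (1 : ℝ)) =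
      -((1 - 0) * y 1 / 2) * gaussVortexProfile y := fun y => by
    rw [fderiv_gaussVortexProfile_single]; ring
  rw [strainedVorticityOperator_weight_mul (contDiff_gaussVortexProfile (n := 2)) hu 0 hρ0 hρ1 x,
    fderiv_apply_self_eq_coord, inv_mul_cancel_left₀ (gaussVortexProfile_pos x).ne']
  ring

/-! ### (I1) The energy identity `⟨Lw, w⟩_X = −∫ G |∇u|²` -/

/-- **(I1), quantitative form**: for `u ∈ C²(ℝ²)` with `|u|, ‖Du‖, ‖D²u‖ ≤ M` and `w = G u`,
`∫ G⁻¹ (Lw) w = −∫ G ‖Du‖²` (`L = strainedVorticityOperator 0`). [folklore] -/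
theorem coreL_energy_identity_of_bounds {u : EuclideanSpace ℝ (Fin 2) → ℝ} (hu : ContDiff ℝ 2 u) {M : ℝ}
    (h0 : ∀ x, |u x| ≤ M) (h1 : ∀ x, ‖fderiv ℝ u x‖ ≤ M) (h2 : ∀ x, ‖fderiv ℝ (fderiv ℝ u) x‖ ≤ M) :
    ∫ ξ, (gaussVortexProfile ξ)⁻¹ *
        strainedVorticityOperator 0 (fun η => gaussVortexProfile η * u η) ξ * (gaussVortexProfile ξ * u ξ) =
      -∫ ξ, gaussVortexProfile ξ * ‖fderiv ℝ u ξ‖ ^ 2 := by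
  have h0' : ∀ x, ‖u x‖ ≤ M := fun x => by rw [Real.norm_eq_abs]; exact h0 x
  have key := integral_laplacian_sub_half_drift_mul_mul_gaussVortexProfile hu h0' h1 h2
  calc ∫ ξ, (gaussVortexProfile ξ)⁻¹ *
        strainedVorticityOperator 0 (fun η => gaussVortexProfile η * u η) ξ * (gaussVortexProfile ξ * u ξ)
      = ∫ x, (Δ u x - 2⁻¹ * fderiv ℝ u x x) * u x * gaussVortexProfile x := by
        refine integral_congr_ae (Eventually.of_forall fun x => ?_)
        simp only [inv_gaussVortexProfile_mul_strainedVorticityOperator_mul hu x]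
        ring
    _ = -∫ x, ‖fderiv ℝ u x‖ ^ 2 * gaussVortexProfile x := key
    _ = -∫ ξ, gaussVortexProfile ξ * ‖fderiv ℝ u ξ‖ ^ 2 := by
        congr 1
        exact integral_congr_ae (Eventually.of_forall fun x => mul_comm _ _)

/-- **(I1) Energy identity of `L` in `X = L²(G⁻¹)` in ground-state variables** (registered helper toward
`stub_coreInverse`): for `w = G u` with `u ∈ C²(ℝ²)` and `u, Du, D²u` bounded,
`⟨Lw, w⟩_X = ∫ G⁻¹ (Lw) w = −∫ G ‖Du‖²`, `L = strainedVorticityOperator 0 = Δ + ½ξ·∇ + 1`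
(Gallay–Wayne 2005, App. A: `L` is conjugate to the Ornstein–Uhlenbeck operator `Δ − ½ξ·∇`). [folklore] -/
theorem coreL_energy_identity :
    ∀ u : EuclideanSpace ℝ (Fin 2) → ℝ, ContDiff ℝ 2 u →
      (∃ M : ℝ, ∀ ξ, |u ξ| ≤ M ∧ ‖fderiv ℝ u ξ‖ ≤ M ∧ ‖fderiv ℝ (fderiv ℝ u) ξ‖ ≤ M) →
      ∫ ξ, (gaussVortexProfile ξ)⁻¹ *
          strainedVorticityOperator 0 (fun η => gaussVortexProfile η * u η) ξ * (gaussVortexProfile ξ * u ξ) =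
        -∫ ξ, gaussVortexProfile ξ * ‖fderiv ℝ u ξ‖ ^ 2 := by
  intro u hu hM
  obtain ⟨M, hM⟩ := hM
  exact coreL_energy_identity_of_bounds hu (fun x => (hM x).1) (fun x => (hM x).2.1) fun x => (hM x).2.2

/-! ### (I2) The spectral gap `½` -/

/-- **(I2), quantitative form**: for `u ∈ C¹(ℝ²)` with `|u|, ‖Du‖ ≤ M` and `∫ G u = 0`,
`½ ∫ G u² ≤ ∫ G ‖Du‖²`. [folklore] -/
theorem coreL_gap_of_bounds {u : EuclideanSpace ℝ (Fin 2) → ℝ} (hu : ContDiff ℝ 1 u) {M : ℝ}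
    (h0 : ∀ x, |u x| ≤ M) (h1 : ∀ x, ‖fderiv ℝ u x‖ ≤ M) (hmean : ∫ ξ, gaussVortexProfile ξ * u ξ = 0) :
    1 / 2 * ∫ ξ, gaussVortexProfile ξ * u ξ ^ 2 ≤ ∫ ξ, gaussVortexProfile ξ * ‖fderiv ℝ u ξ‖ ^ 2 := by
  have h0' : ∀ x, ‖u x‖ ≤ M := fun x => by rw [Real.norm_eq_abs]; exact h0 x
  have hmean' : ∫ x, u x * gaussVortexProfile x = 0 := by
    rw [← hmean]; exact integral_congr_ae (Eventually.of_forall fun x => mul_comm _ _)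
  have hP := integral_sq_mul_gaussVortexProfile_le hu h0' h1 hmean'
  have e1 : ∫ x, u x ^ 2 * gaussVortexProfile x = ∫ x, gaussVortexProfile x * u x ^ 2 :=
    integral_congr_ae (Eventually.of_forall fun x => mul_comm _ _)
  have e2 : ∫ x, ‖fderiv ℝ u x‖ ^ 2 * gaussVortexProfile x = ∫ x, gaussVortexProfile x * ‖fderiv ℝ u x‖ ^ 2 :=
    integral_congr_ae (Eventually.of_forall fun x => mul_comm _ _)
  rw [e1, e2] at hP
  linarith

/-- **(I2) Spectral gap of `L` in `X = L²(G⁻¹)` on mean-zero vorticities, ground-state form** (registered helper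
toward `stub_coreInverse`): for `u ∈ C¹(ℝ²)` with `u, Du` bounded and `∫ G u = 0` (i.e. `∫ w = 0`, `w = Gu`),
`½ ∫ G u² ≤ ∫ G ‖Du‖²`, i.e. `½‖w‖²_X ≤ −⟨Lw, w⟩_X` (Gallay–Wayne 2005, Prop. 4.1 / App. A). [folklore] -/
theorem coreL_gap :
    ∀ u : EuclideanSpace ℝ (Fin 2) → ℝ, ContDiff ℝ 1 u →
      (∃ M : ℝ, ∀ ξ, |u ξ| ≤ M ∧ ‖fderiv ℝ u ξ‖ ≤ M) →
      (∫ ξ, gaussVortexProfile ξ * u ξ = 0) →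
      1 / 2 * ∫ ξ, gaussVortexProfile ξ * u ξ ^ 2 ≤ ∫ ξ, gaussVortexProfile ξ * ‖fderiv ℝ u ξ‖ ^ 2 := by
  intro u hu hM hmean
  obtain ⟨M, hM⟩ := hM
  exact coreL_gap_of_bounds hu (fun x => (hM x).1) (fun x => (hM x).2) hmean

end Summit.AnomalousDissipation.AnomalousDissipation.Theorems.MarginalStabilityChainStretchedVortexRows

end
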